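import Summits.Ventures.CertifiedArithmetic.LowPrec.AccumulateTree
import Summits.Ventures.CertifiedArithmetic.LowPrec.GemmTieChains

/-!
# Opt / CM-T — Theorem T3(a), chain 1, for EVERY tree shape: a reduction tree of height `h` summing E2M1 × E2M1 products in bfloat16 has an input with relative error exactly `(h-1)/(287+h)`

HONEST FRAMING: certified error envelopes and provably optimal rounding/accumulation schemes for
low-precision formats under stated cost models; every table by two implementations; no hardware or
vendor claims.

Setting (OPTIMA.md §T, Theorem T3; cost model CM-T of COST-MODELS.md): `n` exact products of E2M1
values (the 37-letter alphabet `piE2M1` of `GemmTieChains.lean`) are summed by a fixed binary tree,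
each internal node one bfloat16 round-to-nearest-even addition (`SumTree.eval (flα Format.BFloat16)`).
The worst case `W(shape) = max |ŝ - s| / Σ|tᵢ|` is bounded BELOW, for every shape of height `h ≥ 1`, by
the TIE CHAIN along a deepest path: put `36, 36` on a deepest cherry (`36 + 36 = 72`, exact) and the
letter `¼` in the sibling subtree of each of the `h - 1` higher path nodes (all other leaves `0`); at
every one of them the node computes `fl(72 + ¼) = 72` (a midpoint; the even neighbour `72` is kept), so
`ŝ = 72`, `s = Σ|tᵢ| = 72 + (h-1)/4` and `|ŝ - s| / Σ|tᵢ| = (h-1)/(287+h)`. This file constructs that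
relabelling `chain1 t` for an ARBITRARY tree `t` and proves the identity for all `t` (structural
induction + three `decide` facts about bfloat16), i.e. the chain-1 half of OPTIMA.md T3(a):
`W(shape) ≥ (h-1)/(287+h)`. With `h ≥ ⌈log₂ n⌉` this is the lower bound that the certificate C12
shows the recursive-halving tree ATTAINS for `2^(h-1) < n ≤ 3·2^(h-2)` (`n ≤ 48`), where pairwise
summation is therefore exactly minimax-optimal among all reduction trees (OPTIMA.md T3(c)). The
chain-2 bound `κ/(256+κ)` and all upper bounds are certificate-only.

* `spike c t`: the relabelling of `t` with `c` on its left-most leaf and `0` elsewhere (`spike 0 t` is the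
  bare shape); `chain1 t`: the witness relabelling; `spike_zero_chain1`: it has the shape of `t`;
* `chain1_eval` / `chain1_exact` / `chain1_absLeafSum`: `ŝ = 72`, `s = Σ|tᵢ| = 72 + (h-1)/4`;
* `chain1_leaves_mem`: every leaf is an E2M1 × E2M1 product (`36 = 6·6`, `¼ = ½·½`, `0`);
* `t3_chain1_ratio`: `|ŝ - s| / Σ|tᵢ| = (h-1)/(287+h)` — the packaged lower-bound witness.
-/

namespace Summit.Ventures.CertifiedArithmetic.LowPrec.Opt

open Literature.ComputerArithmetic.JeannerodRump2018 (SumTree)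
open Literature.ComputerArithmetic.FloatingPoint (Format)
open Literature.ComputerArithmetic.FloatingPoint.MiniFloat (flα absLeafSum treeHeight piE2M1)

/-- The relabelling of `t` carrying `c` on its left-most leaf and `0` on every other leaf. [folklore] -/
def spike (c : ℚ) : SumTree → SumTree
  | .leaf _ => .leaf c
  | .node l r => .node (spike c l) (spike 0 r)

/-- The chain-1 witness relabelling of `t`: descend along a highest child; at the bottom cherry put
`36, 36`; the sibling subtree of every higher path node carries one `¼`. [new] -/
def chain1 : SumTree → SumTree
  | .leaf _ => .leaf 36
  | .node l r =>
      if treeHeight r ≤ treeHeight l then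
        .node (chain1 l) (spike (if treeHeight l = 0 then 36 else 1 / 4) r)
      else
        .node (spike (1 / 4) l) (chain1 r)

/-! ### bfloat16 facts (executable model, kernel-checked) -/

/-- `fl(0) = 0`. [folklore] -/
theorem flBF_zero : flα Format.BFloat16 0 = 0 := by decide +kernel
/-- `fl(¼) = ¼`. [folklore] -/
theorem flBF_quarter : flα Format.BFloat16 (1 / 4) = 1 / 4 := by decide +kernel
/-- `fl(72) = 72` (`36 + 36` is exact). [folklore] -/
theorem flBF_72 : flα Format.BFloat16 72 = 72 := by decide +kernel
/-- THE TIE: `72 + ¼` is the midpoint of the bfloat16 neighbours `72` and `72.5`; nearest-even keeps `72`. [folklore] -/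
theorem flBF_72_quarter : flα Format.BFloat16 (72 + 1 / 4) = 72 := by decide +kernel

/-! ### The spike relabelling -/

/-- A spike has the height of its shape. [folklore] -/
theorem treeHeight_spike (c : ℚ) : ∀ t, treeHeight (spike c t) = treeHeight t
  | .leaf _ => rfl
  | .node l r => by simp only [spike, treeHeight, treeHeight_spike]

/-- The exact sum of a spike is its letter. [folklore] -/
theorem exact_spike (c : ℚ) : ∀ t, SumTree.exact (spike c t) = c
  | .leaf _ => rfl
  | .node l r => by simp only [spike, SumTree.exact, exact_spike]; ring

/-- The leaf mass of a spike is `|c|`. [folklore] -/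
theorem absLeafSum_spike (c : ℚ) : ∀ t, absLeafSum (spike c t) = |c|
  | .leaf _ => rfl
  | .node l r => by simp only [spike, absLeafSum, absLeafSum_spike, abs_zero, add_zero]

/-- A spike whose letter is a bfloat16 value evaluates to that letter (every addition is `c + 0` or `0 + 0`). [folklore] -/
theorem eval_spike (c : ℚ) (hc : flα Format.BFloat16 c = c) : ∀ t, SumTree.eval (flα Format.BFloat16) (spike c t) = c
  | .leaf _ => rfl
  | .node l r => by
      simp only [spike, SumTree.eval, eval_spike c hc l, eval_spike 0 flBF_zero r, add_zero, hc]

/-- The leaves of a spike are `c` and zeros. [folklore] -/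
theorem leaves_spike (c : ℚ) : ∀ t, ∀ x ∈ SumTree.leaves (spike c t), x = c ∨ x = 0
  | .leaf _ => by simp [spike, SumTree.leaves]
  | .node l r => by
      intro x hx
      simp only [spike, SumTree.leaves, List.mem_append] at hx
      rcases hx with hx | hx
      · exact leaves_spike c l x hx
      · rcases leaves_spike 0 r x hx with h | h <;> exact Or.inr h

/-- A spike has the shape of `t`. [folklore] -/
theorem spike_zero_spike (c : ℚ) : ∀ t, spike 0 (spike c t) = spike 0 t
  | .leaf _ => rfl
  | .node l r => by simp only [spike, spike_zero_spike]

/-! ### The chain-1 witness -/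

/-- A tree of height `0` is a leaf. [folklore] -/
theorem eq_leaf_of_treeHeight_eq_zero : ∀ t, treeHeight t = 0 → ∃ x, t = .leaf x
  | .leaf x, _ => ⟨x, rfl⟩
  | .node l r, h => by simp [treeHeight] at h

/-- `chain1 t` has the shape of `t`. [new] -/
theorem spike_zero_chain1 : ∀ t, spike 0 (chain1 t) = spike 0 t
  | .leaf _ => rfl
  | .node l r => by
      unfold chain1
      split_ifs <;> simp only [spike, spike_zero_chain1, spike_zero_spike]

/-- `chain1 t` has the height of `t`. [new] -/
theorem treeHeight_chain1 : ∀ t, treeHeight (chain1 t) = treeHeight t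
  | .leaf _ => rfl
  | .node l r => by
      unfold chain1
      split_ifs <;> simp only [treeHeight, treeHeight_chain1, treeHeight_spike]

/-- Every leaf of the witness is `36`, `¼` or `0`. [new] -/
theorem chain1_leaves : ∀ t, ∀ x ∈ SumTree.leaves (chain1 t), x = 36 ∨ x = 1 / 4 ∨ x = 0
  | .leaf _ => by simp [chain1, SumTree.leaves]
  | .node l r => by
      intro x hx
      unfold chain1 at hx
      split_ifs at hx with h1 h2
      · simp only [SumTree.leaves, List.mem_append] at hx
        rcases hx with hx | hx
        · exact chain1_leaves l x hx
        · rcases leaves_spike 36 r x hx with h | h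
          · exact Or.inl h
          · exact Or.inr (Or.inr h)
      · simp only [SumTree.leaves, List.mem_append] at hx
        rcases hx with hx | hx
        · exact chain1_leaves l x hx
        · rcases leaves_spike (1 / 4) r x hx with h | h
          · exact Or.inr (Or.inl h)
          · exact Or.inr (Or.inr h)
      · simp only [SumTree.leaves, List.mem_append] at hx
        rcases hx with hx | hx
        · rcases leaves_spike (1 / 4) l x hx with h | h
          · exact Or.inr (Or.inl h)
          · exact Or.inr (Or.inr h)
        · exact chain1_leaves r x hx

/-- Every leaf of the witness is an `E2M1 × E2M1` product. [new] -/
theorem chain1_leaves_mem (t : SumTree) : ∀ x ∈ SumTree.leaves (chain1 t), x ∈ piE2M1 := by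
  intro x hx
  rcases chain1_leaves t x hx with rfl | rfl | rfl <;> norm_num [piE2M1]

/-- THE INDUCTION: for height `h ≥ 1` the witness evaluates to `72`, with exact sum and leaf mass
`72 + (h-1)/4`. [new] -/
theorem chain1_spec : ∀ t, 1 ≤ treeHeight t →
    SumTree.eval (flα Format.BFloat16) (chain1 t) = 72 ∧
    SumTree.exact (chain1 t) = 72 + ((treeHeight t : ℚ) - 1) / 4 ∧
    absLeafSum (chain1 t) = 72 + ((treeHeight t : ℚ) - 1) / 4
  | .leaf _, h => by simp [treeHeight] at h
  | .node l r, _ => by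
      unfold chain1
      split_ifs with hrl hl0
      · -- bottom of the path: `l` and `r` are leaves, the cherry `36 + 36`
        have hr0 : treeHeight r = 0 := Nat.le_zero.mp (hl0 ▸ hrl)
        obtain ⟨x, rfl⟩ := eq_leaf_of_treeHeight_eq_zero l hl0
        obtain ⟨y, rfl⟩ := eq_leaf_of_treeHeight_eq_zero r hr0
        norm_num [chain1, spike, SumTree.eval, SumTree.exact, absLeafSum, treeHeight, flBF_72]
      · -- a higher path node: `fl(72 + ¼) = 72`
        have hl1 : 1 ≤ treeHeight l := Nat.one_le_iff_ne_zero.mpr hl0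
        obtain ⟨he, hx, ha⟩ := chain1_spec l hl1
        have hmax : max (treeHeight l) (treeHeight r) = treeHeight l := max_eq_left hrl
        refine ⟨?_, ?_, ?_⟩
        · simp only [SumTree.eval, he, eval_spike (1 / 4) flBF_quarter r, flBF_72_quarter]
        · simp only [SumTree.exact, hx, exact_spike, treeHeight, hmax]; push_cast; ring
        · simp only [absLeafSum, ha, absLeafSum_spike, treeHeight, hmax]; push_cast
          rw [abs_of_pos (by norm_num : (0 : ℚ) < 1 / 4)]; ring
      · -- the path descends to the right
        have hr1 : 1 ≤ treeHeight r := by omega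
        obtain ⟨he, hx, ha⟩ := chain1_spec r hr1
        have hmax : max (treeHeight l) (treeHeight r) = treeHeight r := max_eq_right (by omega)
        refine ⟨?_, ?_, ?_⟩
        · simp only [SumTree.eval, he, eval_spike (1 / 4) flBF_quarter l]
          rw [show (1 : ℚ) / 4 + 72 = 72 + 1 / 4 by ring, flBF_72_quarter]
        · simp only [SumTree.exact, hx, exact_spike, treeHeight, hmax]; push_cast; ring
        · simp only [absLeafSum, ha, absLeafSum_spike, treeHeight, hmax]; push_cast
          rw [abs_of_pos (by norm_num : (0 : ℚ) < 1 / 4)]; ring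

/-- The witness evaluates to `72` in bfloat16 RNE. [new] -/
theorem chain1_eval (t : SumTree) (ht : 1 ≤ treeHeight t) :
    SumTree.eval (flα Format.BFloat16) (chain1 t) = 72 := (chain1_spec t ht).1

/-- The exact sum of the witness is `72 + (h-1)/4`. [new] -/
theorem chain1_exact (t : SumTree) (ht : 1 ≤ treeHeight t) :
    SumTree.exact (chain1 t) = 72 + ((treeHeight t : ℚ) - 1) / 4 := (chain1_spec t ht).2.1

/-- The leaf mass `Σ|tᵢ|` of the witness is `72 + (h-1)/4` (all leaves are nonnegative). [new] -/
theorem chain1_absLeafSum (t : SumTree) (ht : 1 ≤ treeHeight t) :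
    absLeafSum (chain1 t) = 72 + ((treeHeight t : ℚ) - 1) / 4 := (chain1_spec t ht).2.2

/-- OPTIMA.md Theorem T3(a), chain 1, ALL shapes: every reduction tree `t` with at least one addition
admits a relabelling of the same shape by `E2M1 × E2M1` products whose bfloat16 (RNE) evaluation has
relative error EXACTLY `(h-1)/(287+h)`, `h` the height; hence `W(shape) ≥ (h-1)/(287+h) ≥
(⌈log₂ n⌉-1)/(287+⌈log₂ n⌉)`. [new] -/
theorem t3_chain1_ratio (t : SumTree) (ht : 1 ≤ treeHeight t) :
    spike 0 (chain1 t) = spike 0 t ∧ (∀ x ∈ SumTree.leaves (chain1 t), x ∈ piE2M1) ∧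
    |SumTree.eval (flα Format.BFloat16) (chain1 t) - SumTree.exact (chain1 t)| / absLeafSum (chain1 t)
      = ((treeHeight t : ℚ) - 1) / (287 + treeHeight t) := by
  refine ⟨spike_zero_chain1 t, chain1_leaves_mem t, ?_⟩
  obtain ⟨he, hx, ha⟩ := chain1_spec t ht
  have h1 : (1 : ℚ) ≤ treeHeight t := by exact_mod_cast ht
  rw [he, hx, ha, show (72 : ℚ) - (72 + ((treeHeight t : ℚ) - 1) / 4) = -(((treeHeight t : ℚ) - 1) / 4) by ring,
    abs_neg, abs_of_nonneg (by linarith)]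
  have hne : (72 : ℚ) + ((treeHeight t : ℚ) - 1) / 4 ≠ 0 := by
    have : (0 : ℚ) < 72 + ((treeHeight t : ℚ) - 1) / 4 := by linarith
    exact ne_of_gt this
  have hne' : (287 : ℚ) + (treeHeight t : ℚ) ≠ 0 := by
    have : (0 : ℚ) < 287 + (treeHeight t : ℚ) := by linarith
    exact ne_of_gt this
  rw [div_eq_div_iff hne hne']
  ring

/-- Instance (sanity, kernel-checked): for the sequential shape on four leaves the construction is
`((36 + 36) + ¼) + ¼`, height `3`, ratio `2/290 = 1/145` — the gemm seat's certified `W(4)`. [new] -/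
example : chain1 (.node (.node (.node (.leaf 0) (.leaf 0)) (.leaf 0)) (.leaf 0)) =
    .node (.node (.node (.leaf 36) (.leaf 36)) (.leaf (1 / 4))) (.leaf (1 / 4)) := rfl

end Summit.Ventures.CertifiedArithmetic.LowPrec.Opt
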